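import Summits.NavierStokesRegularity.NavierStokesRegularity.Theorems.FilamentSkeletonRssCoreLinearInvertibilityRadialBlockToolsB

/-!
# Even sector of crux `CoreLinearInvertibility` (stmt-NavierStokesRegularity-17973), line `Sketch`:
# the radial block with a divergence-form source — part B, the corrector integral

The radial corrector for the coupling source `−λ(4r)⁻¹(r²a)′` is built on the Volterra integral
`P_a(r) = ∫₀ʳ e^{s²/4} s a(s) ds`: `Z = −(λ/4) e^{−r²/4} P_a − K e^{−r²/4}` solves
`rZ′ + (r²/2)Z = −(λ/4) r² a` (its flux IS the coupling flux). This file proves the one genuinely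
analytic input, a weighted Schur/Young bound WITHOUT Fubini:

  `∫₀ᵇ e^{βr²/4} (e^{−r²/4} P_a(r))² r dr ≤ (16/(2−β)²) ∫₀ᵇ e^{βr²/4} a² r dr`   (`0 < β ≤ 1`),

by Cauchy–Schwarz with the kernel split `e^{∓θ(r²−s²)}`, `θ = (2−β)/16`, an explicit Gaussian
integral, and the ODE `A′ = φ − 4θ r A` for `A(r) = ∫₀ʳ φ(s) e^{−2θ(r²−s²)} ds`, which gives
`∫₀ᵇ r A ≤ (4θ)⁻¹ ∫₀ᵇ φ`. Only the UNWEIGHTED weighted-`L²` norm of `a` appears (no moments): this is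
what makes the even-sector coupling close.
-/

set_option linter.dupNamespace false

noncomputable section

namespace Summit.NavierStokesRegularity.NavierStokesRegularity.Theorems

open MeasureTheory Filter Topology Set intervalIntegral

/-! ### Two one-variable primitives -/

/-- `∫₀ʳ s e^{γ s²} ds = (e^{γ r²} − 1)/(2γ)` for `γ ≠ 0`. [folklore] -/
theorem intervalIntegral_mul_exp_mul_sq {γ : ℝ} (hγ : γ ≠ 0) (r : ℝ) :
    ∫ s in 0..r, s * Real.exp (γ * s ^ 2) = (Real.exp (γ * r ^ 2) - 1) / (2 * γ) := by
  have hd : ∀ s ∈ uIcc 0 r, HasDerivAt (fun x => Real.exp (γ * x ^ 2) / (2 * γ)) (s * Real.exp (γ * s ^ 2)) s := by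
    intro s _
    refine ((hasDerivAt_exp_mul_sq γ s).div_const (2 * γ)).congr_deriv ?_
    field_simp
  rw [integral_eq_sub_of_hasDerivAt hd ((by fun_prop : Continuous fun s : ℝ => s * Real.exp (γ * s ^ 2)).intervalIntegrable _ _)]
  simp only [pow_two (0:ℝ), mul_zero, Real.exp_zero]
  field_simp

/-- **The ODE trick**: for continuous `φ` and `θ ≠ 0`, with
`A(r) = e^{−2θr²} ∫₀ʳ φ(s) e^{2θs²} ds` (`= ∫₀ʳ φ(s) e^{−2θ(r²−s²)} ds`): `A′ = φ − 4θ r A`, hence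
`∫₀ᵇ r A(r) dr = (∫₀ᵇ φ − A(b))/(4θ)`. [folklore] -/
theorem intervalIntegral_mul_volterra_eq {θ b : ℝ} (hθ : θ ≠ 0) {φ : ℝ → ℝ} (hφ : Continuous φ) :
    ∫ r in 0..b, r * (Real.exp (-(2 * θ) * r ^ 2) * ∫ s in 0..r, φ s * Real.exp (2 * θ * s ^ 2)) =
      ((∫ r in 0..b, φ r) - Real.exp (-(2 * θ) * b ^ 2) * ∫ s in 0..b, φ s * Real.exp (2 * θ * s ^ 2)) /
        (4 * θ) := by
  set Q : ℝ → ℝ := fun r => ∫ s in 0..r, φ s * Real.exp (2 * θ * s ^ 2) with hQ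
  set A : ℝ → ℝ := fun r => Real.exp (-(2 * θ) * r ^ 2) * Q r with hA
  have hic : Continuous fun s => φ s * Real.exp (2 * θ * s ^ 2) := by fun_prop
  have hQ' : ∀ r, HasDerivAt Q (φ r * Real.exp (2 * θ * r ^ 2)) r := fun r =>
    intervalIntegral.integral_hasDerivAt_right (hic.intervalIntegrable _ _)
      (hic.stronglyMeasurableAtFilter _ _) hic.continuousAt
  have hA' : ∀ r, HasDerivAt A (φ r - 4 * θ * (r * A r)) r := by
    intro r
    have h := (hasDerivAt_exp_mul_sq (-(2 * θ)) r).mul (hQ' r)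
    refine h.congr_deriv ?_
    simp only [hA]
    have he : Real.exp (-(2 * θ) * r ^ 2) * Real.exp (2 * θ * r ^ 2) = 1 := by
      rw [← Real.exp_add]; simp [neg_mul]
    linear_combination (φ r) * he
  have hAc : Continuous A := continuous_iff_continuousAt.2 fun r => (hA' r).continuousAt
  have hi1 : IntervalIntegrable φ volume 0 b := hφ.intervalIntegrable _ _
  have hi2 : IntervalIntegrable (fun r => 4 * θ * (r * A r)) volume 0 b :=
    (continuous_const.mul (continuous_id.mul hAc)).intervalIntegrable _ _
  have hftc : ∫ r in 0..b, (φ r - 4 * θ * (r * A r)) = A b - A 0 :=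
    integral_eq_sub_of_hasDerivAt (fun r _ => hA' r) (hi1.sub hi2)
  have hA0 : A 0 = 0 := by simp [hA, hQ]
  rw [intervalIntegral.integral_sub hi1 hi2, intervalIntegral.integral_const_mul, hA0, sub_zero] at hftc
  have e : ∫ r in 0..b, r * A r = ((∫ r in 0..b, φ r) - A b) / (4 * θ) := by
    field_simp
    linarith
  simpa [hA] using e

/-! ### The Schur bound -/

/-- **Weighted Volterra (Schur/Young) bound for the corrector.** For continuous `a`, `β ≤ 1` and
`b ≥ 0`:
`∫₀ᵇ e^{βr²/4} (e^{−r²/4} ∫₀ʳ e^{s²/4} s a(s) ds)² r dr ≤ (16/(2−β)²) ∫₀ᵇ e^{βr²/4} a(r)² r dr`.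
Proof: Cauchy–Schwarz `(∫ fg)² ≤ (∫f²)(∫g²)` with `f = e^{βs²/8 − θ(r²−s²)} √s a`,
`g = e^{s²/4 − βs²/8 + θ(r²−s²)} √s`, `θ = (2−β)/16`; `∫₀ʳ g² ≤ e^{(2−β)r²/4}/(2γ)`, `γ = (2−β)/8`,
so the integrand is `≤ r A(r)/(2γ)` with `A(r) = ∫₀ʳ e^{βs²/4} s a² e^{−2θ(r²−s²)}`, and
`∫₀ᵇ rA ≤ (4θ)⁻¹ ∫₀ᵇ e^{βs²/4} s a²`. [folklore] -/
theorem radial_volterra_sq_le {β b : ℝ} (hβ1 : β ≤ 1) (hb : 0 ≤ b) {a : ℝ → ℝ}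
    (hac : Continuous a) :
    ∫ r in 0..b, Real.exp (β / 4 * r ^ 2) *
        (Real.exp (-(r ^ 2 / 4)) * ∫ s in 0..r, Real.exp (s ^ 2 / 4) * (s * a s)) ^ 2 * r ≤
      16 / (2 - β) ^ 2 * ∫ r in 0..b, Real.exp (β / 4 * r ^ 2) * a r ^ 2 * r := by
  set θ : ℝ := (2 - β) / 16 with hθ
  set γ : ℝ := (2 - β) / 8 with hγ
  have h2β : 0 < 2 - β := by linarith
  have hθ0 : 0 < θ := by rw [hθ]; positivity
  have hγ0 : 0 < γ := by rw [hγ]; positivity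
  -- the Volterra integral and the auxiliary `A`
  set P : ℝ → ℝ := fun r => ∫ s in 0..r, Real.exp (s ^ 2 / 4) * (s * a s) with hP
  set φ : ℝ → ℝ := fun s => Real.exp (β / 4 * s ^ 2) * a s ^ 2 * s with hφdef
  set A : ℝ → ℝ := fun r => Real.exp (-(2 * θ) * r ^ 2) * ∫ s in 0..r, φ s * Real.exp (2 * θ * s ^ 2) with hA
  have hφc : Continuous φ := by simp only [hφdef]; fun_prop
  have hPic : Continuous fun s => Real.exp (s ^ 2 / 4) * (s * a s) := by fun_prop
  have hPc : Continuous P := by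
    simp only [hP]
    exact intervalIntegral.continuous_primitive (fun _ _ => hPic.intervalIntegrable _ _) 0
  have hAic : Continuous fun s => φ s * Real.exp (2 * θ * s ^ 2) := by fun_prop
  have hAc : Continuous A := by
    simp only [hA]
    exact (by fun_prop : Continuous fun r => Real.exp (-(2 * θ) * r ^ 2)).mul
      (intervalIntegral.continuous_primitive (fun _ _ => hAic.intervalIntegrable _ _) 0)
  have hA_nonneg : ∀ r, 0 ≤ r → 0 ≤ A r := by
    intro r hr
    simp only [hA]
    refine mul_nonneg (Real.exp_pos _).le (intervalIntegral.integral_nonneg hr fun s hs => ?_)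
    simp only [hφdef]
    have := hs.1
    positivity
  -- the pointwise Cauchy–Schwarz bound
  have hpt : ∀ r ∈ Icc 0 b, Real.exp (β / 4 * r ^ 2) * (Real.exp (-(r ^ 2 / 4)) * P r) ^ 2 * r ≤
      1 / (2 * γ) * (r * A r) := by
    intro r hr
    have hr0 : 0 ≤ r := hr.1
    set f : ℝ → ℝ := fun s => Real.exp (β / 8 * s ^ 2 - θ * (r ^ 2 - s ^ 2)) * (Real.sqrt s * a s) with hf
    set g : ℝ → ℝ := fun s => Real.exp (s ^ 2 / 4 - β / 8 * s ^ 2 + θ * (r ^ 2 - s ^ 2)) * Real.sqrt s with hg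
    have hfc : Continuous f := by simp only [hf]; fun_prop
    have hgc : Continuous g := by simp only [hg]; fun_prop
    have hcs := sq_intervalIntegral_mul_le hr0 (f := f) (g := g) ((hfc.pow 2).intervalIntegrable _ _)
      ((hgc.pow 2).intervalIntegrable _ _) ((hfc.mul hgc).intervalIntegrable _ _)
    -- `∫ f g = P r`
    have e1 : ∫ s in 0..r, f s * g s = P r := by
      simp only [hP]
      refine intervalIntegral.integral_congr fun s hs => ?_
      rw [uIcc_of_le hr0] at hs
      simp only [hf, hg]
      have hss : Real.sqrt s * Real.sqrt s = s := Real.mul_self_sqrt hs.1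
      have he : Real.exp (β / 8 * s ^ 2 - θ * (r ^ 2 - s ^ 2)) *
          Real.exp (s ^ 2 / 4 - β / 8 * s ^ 2 + θ * (r ^ 2 - s ^ 2)) = Real.exp (s ^ 2 / 4) := by
        rw [← Real.exp_add]; ring_nf
      calc Real.exp (β / 8 * s ^ 2 - θ * (r ^ 2 - s ^ 2)) * (Real.sqrt s * a s) *
            (Real.exp (s ^ 2 / 4 - β / 8 * s ^ 2 + θ * (r ^ 2 - s ^ 2)) * Real.sqrt s)
          = (Real.exp (β / 8 * s ^ 2 - θ * (r ^ 2 - s ^ 2)) *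
              Real.exp (s ^ 2 / 4 - β / 8 * s ^ 2 + θ * (r ^ 2 - s ^ 2))) * ((Real.sqrt s * Real.sqrt s) * a s) := by
            ring
        _ = Real.exp (s ^ 2 / 4) * (s * a s) := by rw [he, hss]
    -- `∫ f² = A r`
    have e2 : ∫ s in 0..r, f s ^ 2 = A r := by
      simp only [hA]
      rw [← intervalIntegral.integral_const_mul]
      refine intervalIntegral.integral_congr fun s hs => ?_
      rw [uIcc_of_le hr0] at hs
      simp only [hf, hφdef]
      have hss : Real.sqrt s ^ 2 = s := Real.sq_sqrt hs.1
      have he : Real.exp (β / 8 * s ^ 2 - θ * (r ^ 2 - s ^ 2)) ^ 2 =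
          Real.exp (-(2 * θ) * r ^ 2) * (Real.exp (β / 4 * s ^ 2) * Real.exp (2 * θ * s ^ 2)) := by
        rw [← Real.exp_nat_mul, ← Real.exp_add, ← Real.exp_add]; ring_nf
      calc (Real.exp (β / 8 * s ^ 2 - θ * (r ^ 2 - s ^ 2)) * (Real.sqrt s * a s)) ^ 2
          = Real.exp (β / 8 * s ^ 2 - θ * (r ^ 2 - s ^ 2)) ^ 2 * Real.sqrt s ^ 2 * a s ^ 2 := by ring
        _ = Real.exp (-(2 * θ) * r ^ 2) * (Real.exp (β / 4 * s ^ 2) * a s ^ 2 * s * Real.exp (2 * θ * s ^ 2)) := by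
            rw [he, hss]; ring
    -- `∫ g² ≤ e^{(2−β)r²/4}/(2γ)`
    have e3 : ∫ s in 0..r, g s ^ 2 ≤ Real.exp ((2 - β) / 4 * r ^ 2) / (2 * γ) := by
      have hg2 : ∀ s ∈ uIcc 0 r, g s ^ 2 = Real.exp (2 * θ * r ^ 2) * (s * Real.exp (γ * s ^ 2)) := by
        intro s hs
        rw [uIcc_of_le hr0] at hs
        simp only [hg]
        have hss : Real.sqrt s ^ 2 = s := Real.sq_sqrt hs.1
        have he : Real.exp (s ^ 2 / 4 - β / 8 * s ^ 2 + θ * (r ^ 2 - s ^ 2)) ^ 2 =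
            Real.exp (2 * θ * r ^ 2) * Real.exp (γ * s ^ 2) := by
          rw [← Real.exp_nat_mul, ← Real.exp_add]
          congr 1
          simp only [hγ, hθ]
          push_cast
          ring
        rw [mul_pow, he, hss]; ring
      rw [intervalIntegral.integral_congr hg2, intervalIntegral.integral_const_mul,
        intervalIntegral_mul_exp_mul_sq hγ0.ne' r]
      have hkey : Real.exp (2 * θ * r ^ 2) * ((Real.exp (γ * r ^ 2) - 1) / (2 * γ)) ≤
          Real.exp (2 * θ * r ^ 2) * (Real.exp (γ * r ^ 2) / (2 * γ)) := by
        refine mul_le_mul_of_nonneg_left ?_ (Real.exp_pos _).le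
        exact div_le_div_of_nonneg_right (by linarith) (by positivity)
      refine hkey.trans_eq ?_
      rw [mul_div_assoc', ← Real.exp_add]
      congr 2
      simp only [hγ, hθ]; ring
    -- assemble the pointwise bound
    have hP2 : P r ^ 2 ≤ A r * (Real.exp ((2 - β) / 4 * r ^ 2) / (2 * γ)) := by
      rw [← e1, ← e2]
      exact hcs.trans (mul_le_mul_of_nonneg_left e3 (by rw [e2]; exact hA_nonneg r hr0))
    have hexp : Real.exp (β / 4 * r ^ 2) * Real.exp (-(r ^ 2 / 4)) ^ 2 * Real.exp ((2 - β) / 4 * r ^ 2) = 1 := by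
      rw [← Real.exp_nat_mul, ← Real.exp_add, ← Real.exp_add]
      convert Real.exp_zero using 2
      push_cast; ring
    calc Real.exp (β / 4 * r ^ 2) * (Real.exp (-(r ^ 2 / 4)) * P r) ^ 2 * r
        = (Real.exp (β / 4 * r ^ 2) * Real.exp (-(r ^ 2 / 4)) ^ 2) * P r ^ 2 * r := by ring
      _ ≤ (Real.exp (β / 4 * r ^ 2) * Real.exp (-(r ^ 2 / 4)) ^ 2) *
          (A r * (Real.exp ((2 - β) / 4 * r ^ 2) / (2 * γ))) * r := by
          gcongr
      _ = (Real.exp (β / 4 * r ^ 2) * Real.exp (-(r ^ 2 / 4)) ^ 2 * Real.exp ((2 - β) / 4 * r ^ 2)) *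
          (1 / (2 * γ) * (r * A r)) := by ring
      _ = 1 / (2 * γ) * (r * A r) := by rw [hexp, one_mul]
  -- integrate
  have hIl : IntervalIntegrable (fun r => Real.exp (β / 4 * r ^ 2) * (Real.exp (-(r ^ 2 / 4)) * P r) ^ 2 * r)
      volume 0 b := by
    apply Continuous.intervalIntegrable
    exact ((by fun_prop : Continuous fun r => Real.exp (β / 4 * r ^ 2)).mul
      (((by fun_prop : Continuous fun r => Real.exp (-(r ^ 2 / 4))).mul hPc).pow 2)).mul continuous_id
  have hIr : IntervalIntegrable (fun r => 1 / (2 * γ) * (r * A r)) volume 0 b :=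
    ((continuous_id.mul hAc).const_mul _).intervalIntegrable _ _
  have hmono := intervalIntegral.integral_mono_on hb hIl hIr hpt
  rw [intervalIntegral.integral_const_mul] at hmono
  -- `∫ rA ≤ (4θ)⁻¹ ∫ φ`
  have hvol := intervalIntegral_mul_volterra_eq (b := b) hθ0.ne' hφc
  have hrA : ∫ r in 0..b, r * A r ≤ (∫ r in 0..b, φ r) / (4 * θ) := by
    have hAb : 0 ≤ Real.exp (-(2 * θ) * b ^ 2) * ∫ s in 0..b, φ s * Real.exp (2 * θ * s ^ 2) := hA_nonneg b hb
    have e : ∫ r in 0..b, r * A r =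
        ((∫ r in 0..b, φ r) - Real.exp (-(2 * θ) * b ^ 2) * ∫ s in 0..b, φ s * Real.exp (2 * θ * s ^ 2)) /
          (4 * θ) := hvol
    rw [e]
    exact div_le_div_of_nonneg_right (by linarith) (by positivity)
  have hφI : ∫ r in 0..b, φ r = ∫ r in 0..b, Real.exp (β / 4 * r ^ 2) * a r ^ 2 * r := rfl
  have hconst : 1 / (2 * γ) * ((∫ r in 0..b, φ r) / (4 * θ)) = 16 / (2 - β) ^ 2 * ∫ r in 0..b, φ r := by
    simp only [hγ, hθ]
    field_simp
    ring
  calc ∫ r in 0..b, Real.exp (β / 4 * r ^ 2) * (Real.exp (-(r ^ 2 / 4)) * P r) ^ 2 * r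
      ≤ 1 / (2 * γ) * ∫ r in 0..b, r * A r := hmono
    _ ≤ 1 / (2 * γ) * ((∫ r in 0..b, φ r) / (4 * θ)) := mul_le_mul_of_nonneg_left hrA (by positivity)
    _ = 16 / (2 - β) ^ 2 * ∫ r in 0..b, Real.exp (β / 4 * r ^ 2) * a r ^ 2 * r := by rw [hconst, hφI]

end Summit.NavierStokesRegularity.NavierStokesRegularity.Theorems
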